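import Literature.Algebra.Module.LevelwiseSupport
import Literature.NumberTheory.EllipticCurves.TwoVariableSelmerDual
import Mathlib.RingTheory.PowerSeries.NoZeroDivisors
import HarnessLib

/-!
# Torsion lifts from a prime section — the algebra of stub S0 (`stub_xGrIsTorsion`) of line `bdpline` on
# the crux `AnticyclotomicEisensteinDivisibility` (stmt-BirchSwinnertonDyer-20727, route SignedBaseChange)

Lead prover sbc-p1 g6 (2026-08-27). Stub S0 asks that the two-variable Greenberg Selmer dual
`X_Gr(E/K_∞)` be `Λ_K`-torsion (the integral crux is torsion-unguarded: off the torsion locus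
`Module.charIdeal = ⊤` and the crux would assert that `G⁻` is a unit). At a good ordinary prime this is
print (`SignedBaseChangeAcDivOrdinary.xGr₂_isTorsion_of_goodOrd`, p550979); at a supersingular prime and
additive conductor it is not in print for `X_Gr(E/K_∞)` itself, but the ONE-variable anticyclotomic
Greenberg/BDP Selmer dual `X_Gr(E/K_∞⁻)` is known to be `Λ_ac`-torsion in many cases. This file proves the
commutative algebra that lifts torsion from the anticyclotomic line `T₁ = 0` to the `ℤ_p²`-tower:

* `exists_smul_eq_zero_notMem_of_forall` — for a finitely generated module `M` over a commutative ring `R`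
  and a PRIME ideal `P`: if every `m ∈ M` has some `s ∉ P` with `s·m ∈ P·M` ("`M/PM` is torsion over
  `R/P`"), then ONE `t ∉ P` kills `M` (Cayley–Hamilton / determinant trick: `t ≡ (∏ sᵢ)^d mod P`);
* `isTorsion_of_forall` — over a domain, such an `M` is torsion;
* `xGr₂_isTorsion_of_finite_of_forall` — S0's shape: `X_Gr(E/K̃_∞)` is `Λ₂`-torsion as soon as it is
  finitely generated and its `T₁`-section is torsion in the above sense (`P = (T₁)`, prime in
  `Λ₂ = ℤ_p⟦T₂⟧⟦T₁⟧`), i.e. S0 ⟸ [finite generation] + [control `X_Gr₂/T₁X_Gr₂ → X_Gr(E/K_∞⁻)` with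
  torsion kernel] + [`Λ_ac`-torsion of `X_Gr(E/K_∞⁻)`] — the last two are the arithmetic inputs, not
  claimed here.
Pure algebra over the tree's CONSTRUCTED module `WeierstrassCurve.XGr₂`; nothing asserted about curves;
no new definitions.
-/

-- D-0017: single-problem summit, the namespace repeats the problem name by design.
set_option linter.dupNamespace false
set_option autoImplicit false

noncomputable section

open scoped Classical

namespace Summit.BirchSwinnertonDyer.BirchSwinnertonDyer.Theorems.SignedBaseChangeAcDivTorsionLift

/-- **Torsion lifts from a prime section (determinant trick).** `R` commutative, `P ⊂ R` prime, `M` a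
finitely generated `R`-module such that every `m ∈ M` admits `s ∉ P` with `s • m ∈ P • M` (i.e. `M/PM` is
a torsion `R/P`-module): then a single `t ∉ P` annihilates `M`. Proof: the product `σ` of the multipliers
of a finite generating set lies outside `P` and maps `M` into `P • M`; Cayley–Hamilton gives `t` with
`t • M = 0`, `t ≡ σ^d (mod P)`. [folklore] -/
theorem exists_smul_eq_zero_notMem_of_forall {R : Type} [CommRing R] {M : Type} [AddCommGroup M]
    [Module R M] [Module.Finite R M] (P : Ideal R) [hP : P.IsPrime]
    (h : ∀ m : M, ∃ s ∉ P, s • m ∈ P • (⊤ : Submodule R M)) :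
    ∃ t ∉ P, ∀ m : M, t • m = 0 := by
  obtain ⟨S, hS⟩ := Module.Finite.fg_top (R := R) (M := M)
  choose s hs using h
  set σ : R := ∏ m ∈ S, s m with hσdef
  have hσ : σ ∉ P := by
    intro hmem
    obtain ⟨m, -, hm⟩ := Ideal.IsPrime.prod_mem_iff.mp hmem
    exact (hs m).1 hm
  have hσM : LinearMap.range (LinearMap.lsmul R M σ) ≤ P • (⊤ : Submodule R M) := by
    rintro _ ⟨m, rfl⟩
    rw [LinearMap.lsmul_apply]
    have hm : m ∈ Submodule.span R (S : Set M) := by rw [hS]; exact Submodule.mem_top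
    induction hm using Submodule.span_induction with
    | mem x hx =>
      rw [hσdef, ← Finset.prod_erase_mul S s hx, mul_smul]
      exact Submodule.smul_mem _ _ (hs x).2
    | zero => simp
    | add x y _ _ hx hy => rw [smul_add]; exact add_mem hx hy
    | smul a x _ hx => rw [smul_comm]; exact Submodule.smul_mem _ a hx
  obtain ⟨t, ht0, htP⟩ :=
    Literature.Algebra.Module.exists_smul_eq_zero_and_sub_pow_mem (R := R) P σ le_rfl hσM
  refine ⟨t, fun ht ↦ hσ ?_, ht0⟩
  have hpow : σ ^ (⊤ : Submodule R M).spanFinrank ∈ P := by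
    have := P.sub_mem ht htP
    rwa [sub_sub_cancel] at this
  exact hP.mem_of_pow_mem _ hpow

/-- **Over a domain: `M/PM` torsion over `R/P` ⟹ `M` torsion over `R`** (for `M` finitely generated,
`P` prime): the annihilating `t ∉ P` is non-zero. [folklore] -/
theorem isTorsion_of_forall {R : Type} [CommRing R] [IsDomain R] {M : Type} [AddCommGroup M]
    [Module R M] [Module.Finite R M] (P : Ideal R) [P.IsPrime]
    (h : ∀ m : M, ∃ s ∉ P, s • m ∈ P • (⊤ : Submodule R M)) : Module.IsTorsion R M := by
  obtain ⟨t, htP, ht⟩ := exists_smul_eq_zero_notMem_of_forall P h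
  have ht0 : t ≠ 0 := fun h0 ↦ htP (h0 ▸ P.zero_mem)
  intro m
  exact ⟨⟨t, mem_nonZeroDivisors_of_ne_zero ht0⟩, ht m⟩

open Literature.NumberTheory.EllipticCurves in
/-- **Shape of stub S0 of line `bdpline` (stmt-BirchSwinnertonDyer-20727).** For the CONSTRUCTED
two-variable Greenberg Selmer dual `X = X_Gr(E/K̃_∞)` over `Λ₂ = ℤ_p⟦T₂⟧⟦T₁⟧` (`T₁ = PowerSeries.X`, the
cyclotomic variable): if `X` is finitely generated and every `x ∈ X` has a multiplier `s ∉ (T₁)` with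
`s • x ∈ T₁ • X` — which is what control (`X/T₁X → X_Gr(E/K_∞⁻)` with `Λ₁`-torsion kernel) and
`Λ_ac`-torsion of the anticyclotomic Selmer dual deliver — then `X` is `Λ₂`-torsion. [folklore] -/
theorem xGr₂_isTorsion_of_finite_of_forall {K : Type} [Field K] [NumberField K] (W : WeierstrassCurve K)
    (p : ℕ) [Fact p.Prime] (κ₁ κ₂ : ZpExtension K p)
    (vbar : IsDedekindDomain.HeightOneSpectrum (NumberField.RingOfIntegers K))
    (γ₁ γ₂ : Field.absoluteGaloisGroup K) [Fact (ZpExtension.IsTopGeneratorPair κ₁ κ₂ γ₁ γ₂)]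
    [Module.Finite (IwasawaAlgebra₂ p) (W.XGr₂ p κ₁ κ₂ vbar γ₁ γ₂)]
    (h : ∀ x : W.XGr₂ p κ₁ κ₂ vbar γ₁ γ₂, ∃ s ∉ Ideal.span {(PowerSeries.X : IwasawaAlgebra₂ p)},
      s • x ∈ Ideal.span {(PowerSeries.X : IwasawaAlgebra₂ p)} • (⊤ : Submodule (IwasawaAlgebra₂ p) _)) :
    Module.IsTorsion (IwasawaAlgebra₂ p) (W.XGr₂ p κ₁ κ₂ vbar γ₁ γ₂) :=
  haveI : (Ideal.span {(PowerSeries.X : IwasawaAlgebra₂ p)}).IsPrime := PowerSeries.span_X_isPrime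
  isTorsion_of_forall _ h

end Summit.BirchSwinnertonDyer.BirchSwinnertonDyer.Theorems.SignedBaseChangeAcDivTorsionLift

end
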